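import Literature.Geometry.Riemannian.CartanHadamardConjugate
import Literature.Geometry.Riemannian.WeinsteinCutLocusDichotomy
import Mathlib.MeasureTheory.Integral.IntervalIntegral.FundThmCalculus
import HarnessLib

/-!
# A lower bound for the conjugate radius: `sec ≤ Λ` and `Λ |v|² < 2` ⇒ `v` is not conjugate
(weak form of the conjugate point comparison theorem, Lee 2018, Thm. 11.12; Chavel 2006, §III.2 item 3)

Topic `Geometry/Riemannian`; third support file of the programme towards the named fact
`Weinstein1968_exists_metric_two_le_multiplicity_of_mem_cutLocus` (`WeinsteinCutLocus.lean`).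
After `WeinsteinCutLocusDichotomy.lean` the fact is reduced to Weinstein's printed statement
"no tangent cut vector of `p` is a conjugate vector"; in Weinstein's construction (zbMATH
0159.23902: a metric for which `exp_p` is a diffeomorphism of the unit ball onto a dense disk `D`,
then "Warner's comparison theorem for focal points") the last step is a COMPARISON ARGUMENT:
the cut vectors are short (`|v| ≤ 1 + ε`) and short geodesics carry no conjugate (focal) points
because the curvature is bounded. This file proves the point version of that comparison
principle, by an energy argument which needs only the tree's Jacobi equation for the variation
field of `exp_p` (`jacobi_geodesicVariation`) and metric compatibility along curves
(`hasDerivAt_val_apply_along`) — the same set-up as `CartanHadamard.mfderiv_expMap_injective`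
(the case `Λ = 0`):

* `sq_val_le_mul_val` — Cauchy–Schwarz for a positive semidefinite metric;
* `mfderiv_expMap_injective_of_curvatureForm_le` — **if `Rm(X, Y, Y, X) ≤ Λ (|X|²|Y|² - ⟨X,Y⟩²)`
  (sectional curvature `≤ Λ`, any real `Λ`) then `d(exp_p)_v` is injective whenever
  `Λ g_p(v, v) < 2`.** Lee 2018, Thm. 11.12 (b) gives the sharp range `|v| < π/√Λ` ("if
  `sec ≤ c = 1/R²` … `p` has no conjugate points along any geodesic shorter than `πR`"); the
  constant `√2` here is what the elementary energy argument yields, and suffices for every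
  qualitative use (a positive conjugate radius under a curvature bound);
* `not_isConjugateVector_of_curvatureForm_le` — the same in the vocabulary of
  `ExponentialMap.lean` (`IsConjugateVector`) for a smooth Riemannian metric;
* `two_le_minimalGeodesicMultiplicity_of_curvatureForm_le_of_edist_lt` — **Weinstein's step (4)
  in point form**: on a compact connected manifold, if `sec ≤ Λ` and `p` sees every point within
  distance `r` with `Λ r² < 2`, then no cut vector of `p` is conjugate, so every cut point of `p`
  has minimal-geodesic multiplicity `≥ 2` (`two_le_minimalGeodesicMultiplicity_of_forall_not_isConjugateVector`).

## The energy argument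

With `S(t) = d(exp_p)_{tv}(t w)` the Jacobi field of the variation `γ_{v+sw}`, `T = γ_v'`
(`|T|² ≡ c = g_p(v,v)`, constant speed), `f = |S|²`, `a = g(D_t S, S)`, `h = |D_t S|²`:
`f' = 2a`, `a' = h - Rm(S, T, T, S) ≥ h - Λ₊ c f` (Jacobi equation, curvature bound,
Cauchy–Schwarz), where `Λ₊ = max Λ 0`. Suppose `d(exp_p)_v(w) = S(1) = 0`, so `a(0) = a(1) = 0`.
(A) `t ↦ a - ∫₀ᵗ h + Λ₊ c ∫₀ᵗ f` is nondecreasing, whence `∫₀¹ h ≤ Λ₊ c ∫₀¹ f`.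
(B) `t ↦ ∫₀ᵗ h - f/t` is nondecreasing on `(0, ∞)` (its derivative is
`|t D_tS - S|²/t² ≥ 0`) and tends to `0` at `0⁺` (`f(0) = f'(0) = 0`), so `f(t) ≤ t ∫₀ᵗ h`.
(C) hence `t ↦ t² (∫₀ᵗ h)/2 - ∫₀ᵗ f` is nondecreasing on `[0, ∞)` and `∫₀¹ f ≤ (∫₀¹ h)/2`.
(D) `∫₀¹ h ≤ Λ₊ c (∫₀¹ h)/2` with `Λ₊ c < 2` forces `∫₀¹ h ≤ 0`, so by (B) `f = 0` on `[0, 1]`,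
i.e. `d(exp_p)_{tv}(w) = 0` for `0 < t ≤ 1`, and `t → 0⁺` gives `w = d(exp_p)_0(w) = 0` exactly as
in `CartanHadamardConjugate.lean`.

No definitions, no named facts (D-0026); theorem-only file.

## References

* J. M. Lee, *Introduction to Riemannian Manifolds*, 2nd ed. (2018), Thm. 11.12 (Conjugate Point
  Comparison), Prop. 10.20, Thm. 10.1 (Jacobi equation) [LeeRiemannianManifolds2018].
* I. Chavel, *Riemannian geometry: a modern introduction*, 2nd ed. (2006), Thm. II.6.4 (Rauch),
  §III.2 [Chavel2006].
* A. Weinstein, Ann. of Math. 87 (1968) 29–41 [Weinstein1968]; zbMATH Zbl 0159.23902.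
-/

noncomputable section

open Bundle Set Filter Function MeasureTheory intervalIntegral
open scoped Manifold ContDiff Topology

namespace Literature.Geometry.Riemannian

open Literature.Geometry.Lorentzian
open Literature.Geometry.Lorentzian.PseudoRiemannianMetric

variable {E : Type*} [NormedAddCommGroup E] [NormedSpace ℝ E] {H : Type*} [TopologicalSpace H]
  {I : ModelWithCorners ℝ E H} {M : Type*} [TopologicalSpace M] [ChartedSpace H M]
  [IsManifold I ∞ M] {n : ℕ∞ω}
  {g : PseudoRiemannianMetric I n E (TangentSpace I : M → Type _)}

/-! ### Cauchy–Schwarz for a Riemannian metric -/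

/-- **Cauchy–Schwarz** for a positive semidefinite scalar product: `g(u, w)² ≤ g(u, u) g(w, w)`
(discriminant of the nonnegative quadratic `r ↦ g(u - r w, u - r w)`). [folklore] -/
theorem sq_val_le_mul_val (hnn : ∀ (x : M) (u : TangentSpace I x), 0 ≤ g.val x u u) (x : M)
    (u w : TangentSpace I x) : g.val x u w ^ 2 ≤ g.val x u u * g.val x w w := by
  set a := g.val x u u with ha
  set b := g.val x u w with hb
  set c := g.val x w w with hc
  have hsymm : g.val x w u = b := (g.symm x w u).trans rfl
  -- the quadratic `r ↦ g(u - r w, u - r w) = a - 2 r b + r² c` is nonnegative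
  have hq : ∀ r : ℝ, 0 ≤ a - 2 * r * b + r ^ 2 * c := fun r ↦ by
    have h0 := hnn x (u - r • w)
    have h1 : g.val x (u - r • w) (u - r • w) = a - 2 * r * b + r ^ 2 * c := by
      simp only [map_sub, map_smul, FunLike.coe_sub, FunLike.coe_smul,
        Pi.sub_apply, Pi.smul_apply, smul_eq_mul, hsymm]
      ring
    rw [h1] at h0
    exact h0
  have hc0 : 0 ≤ c := hnn x w
  rcases hc0.eq_or_lt with hc0 | hcpos
  · -- `c = 0`: then `b = 0`
    have hb0 : b = 0 := by
      by_contra hb0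
      have h1 := hq ((a + 1) / (2 * b))
      rw [← hc0] at h1
      have h2 : a - 2 * ((a + 1) / (2 * b)) * b + ((a + 1) / (2 * b)) ^ 2 * 0 = -1 := by
        field_simp
        ring
      rw [h2] at h1
      linarith
    rw [hb0, ← hc0]
    simp
  · have h1 := hq (b / c)
    have h2 : a - 2 * (b / c) * b + (b / c) ^ 2 * c = a - b ^ 2 / c := by
      field_simp
      ring
    rw [h2] at h1
    have h3 : b ^ 2 / c ≤ a := by linarith
    rwa [div_le_iff₀ hcpos] at h3

variable [Fact (1 ≤ n)] [FiniteDimensional ℝ E] [CompleteSpace E] [T2Space M] [I.Boundaryless]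
  [g.HasLeviCivita]
  [CovariantDerivative.ContMDiffCovariantDerivative g.leviCivita 1]
  [CovariantDerivative.ContMDiffCovariantDerivative g.leviCivita ∞]

/-- **Conjugate radius bound (weak conjugate point comparison).** Let `g` be a positive definite
`C^n` metric (`1 ≤ n`) whose Levi-Civita connection is locally `C¹`, `C^∞` and geodesically
complete, on a Hausdorff manifold without boundary, with sectional curvature `≤ Λ` in the form
`Rm(X, Y, Y, X) ≤ Λ (g(X,X) g(Y,Y) - g(X,Y)²)` for all tangent vectors (`Λ ∈ ℝ` arbitrary). Then
for every `v ∈ T_pM` with `Λ g_p(v, v) < 2` the differential `d(exp_p)_v` is injective — `v` is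
not a conjugate vector; i.e. `p` has no conjugate point along `γ_v|[0,1]` when
`|v| < √(2/Λ)`. Lee 2018, Thm. 11.12 (b) is the sharp statement (`|v| < π/√Λ`, by Jacobi field
comparison); this weak form is proved by the energy argument of the module docstring (steps
(A)–(D)), built on the Jacobi equation `D_tD_tS = -R(S,T)T` for `S(t) = d(exp_p)_{tv}(tw)`
(`jacobi_geodesicVariation`, `velocity_geodesicVariation_eq_mfderiv_expMap`) and concluded as in
`CartanHadamard.mfderiv_expMap_injective` (`Λ = 0`). [cite: LeeRiemannianManifolds2018, Thm. 11.12 (b) (weak form) and Prop. 10.20] -/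
theorem mfderiv_expMap_injective_of_curvatureForm_le (hg : g.IsRiemannian) {Λ : ℝ}
    (hsec : ∀ (x : M) (X Y : TangentSpace I x), g.curvatureForm g.leviCivita x X Y Y X ≤
      Λ * (g.val x X X * g.val x Y Y - g.val x X Y ^ 2))
    (hcov₁ : g.leviCivita.IsLocallyContMDiff 1)
    (hc : IsGeodesicallyComplete g.leviCivita) (p : M) {v : E}
    (hv : Λ * g.val p (show TangentSpace I p from v) (show TangentSpace I p from v) < 2) :
    Injective (mfderiv 𝓘(ℝ, E) I
      (fun u : E ↦ expMap g.leviCivita p (show TangentSpace I p from u)) v) := by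
  rw [injective_iff_map_eq_zero]
  intro w hw
  have hLC := isLeviCivita_leviCivita_holds (g := g)
  have htors : g.leviCivita.torsion = 0 := hLC.1
  have hcompat : g.IsCompatible g.leviCivita := hLC.2
  have h2 : (2 : ℕ∞ω) ≤ ∞ := WithTop.coe_le_coe.2 le_top
  -- positive semidefiniteness
  have hnn : ∀ (x : M) (u : TangentSpace I x), 0 ≤ g.val x u u := fun x u ↦ by
    by_cases hu : u = 0
    · subst hu
      simp
    · exact (hg x u hu).le
  -- the vectors read in `T_pM` and the geodesic variation `X t s = γ_{v + s w}(t)`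
  let vT : TangentSpace I p := v
  let wT : TangentSpace I p := w
  set X : ℝ → ℝ → M := fun t s ↦ maximalGeodesic g.leviCivita p (vT + s • wT) t with hX_def
  have hXs : ContMDiff (𝓘(ℝ, ℝ).prod 𝓘(ℝ, ℝ)) I ∞ (uncurry X) :=
    contMDiff_uncurry_geodesicVariation hc p vT wT
  have hX2 : ∀ q : ℝ × ℝ, ContMDiffAt (𝓘(ℝ, ℝ).prod 𝓘(ℝ, ℝ)) I 2 (uncurry X) q :=
    fun q ↦ (hXs q).of_le h2
  -- the curve `γ = X(·, 0)`, the fields `S = ∂_s X(·, 0)`, `T = ∂_t X(·, 0)`, `DS = D_t S`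
  set γ : ℝ → M := fun t ↦ X t 0 with hγ_def
  set S : Π t : ℝ, TangentSpace I (γ t) := fun t ↦ velocity I (X t) 0 with hS_def
  set T : Π t : ℝ, TangentSpace I (γ t) := fun t ↦ velocity I γ t with hT_def
  set DS : Π t : ℝ, TangentSpace I (γ t) := fun t ↦ covariantDerivAlong g.leviCivita γ S t
    with hDS_def
  -- the Jacobi equation `D_t D_t S = -R(S, T) T`
  have hjac : ∀ t₀ : ℝ, covariantDerivAlong g.leviCivita γ DS t₀ +
      g.leviCivita.curvature (γ t₀) (S t₀) (T t₀) (T t₀) = 0 :=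
    fun t₀ ↦ jacobi_geodesicVariation hcov₁ htors hc p vT wT 0 t₀
  -- differentiability of the lifts of `S`, `T`, `DS`
  have hSl : ContMDiff 𝓘(ℝ, ℝ) I.tangent ∞
      (fun t ↦ (TotalSpace.mk' E (γ t) (S t) : TangentBundle I M)) :=
    contMDiff_lift_velocity_geodesicVariation hc p vT wT 0
  have hS : ∀ t, MDifferentiableAt 𝓘(ℝ, ℝ) I.tangent
      (fun t ↦ (TotalSpace.mk' E (γ t) (S t) : TangentBundle I M)) t :=
    fun t ↦ (hSl t).mdifferentiableAt (by simp)
  have hT2 : ∀ q : ℝ × ℝ, ContMDiffAt (𝓘(ℝ, ℝ).prod 𝓘(ℝ, ℝ)) I.tangent 2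
      (fun q : ℝ × ℝ ↦ (TotalSpace.mk' E (X q.1 q.2) (velocity I (fun t' ↦ X t' q.2) q.1) :
        TangentBundle I M)) q :=
    fun q ↦ ((contMDiff_tangentLift_geodesicVariation hc p vT wT) q).of_le h2
  have hsymm : ∀ t, covariantDerivAlong g.leviCivita γ S t =
      covariantDerivAlong g.leviCivita (X t) (fun s ↦ velocity I (fun t' ↦ X t' s) t) 0 :=
    fun t ↦ covariantDerivAlong_velocity_comm g.leviCivita htors (hX2 (t, 0))
  have hDsT : ∀ t, MDifferentiableAt 𝓘(ℝ, ℝ) I.tangent (fun t' ↦ (TotalSpace.mk' E (X t' 0)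
      (covariantDerivAlong g.leviCivita (X t') (fun s ↦ velocity I (fun t'' ↦ X t'' s) t') 0) :
        TangentBundle I M)) t :=
    fun t ↦ mdifferentiableAt_lift_covariantDerivAlong_curry_right g.leviCivita hcov₁
      (hX2 (t, 0)) (hT2 (t, 0))
  have hDS : ∀ t, MDifferentiableAt 𝓘(ℝ, ℝ) I.tangent
      (fun t' ↦ (TotalSpace.mk' E (γ t') (DS t') : TangentBundle I M)) t := by
    intro t
    have heq : (fun t' ↦ (TotalSpace.mk' E (γ t') (DS t') : TangentBundle I M)) =
        fun t' ↦ (TotalSpace.mk' E (X t' 0) (covariantDerivAlong g.leviCivita (X t')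
          (fun s ↦ velocity I (fun t'' ↦ X t'' s) t') 0) : TangentBundle I M) := by
      funext t'
      show (TotalSpace.mk' E (X t' 0) (covariantDerivAlong g.leviCivita γ S t') :
          TangentBundle I M) = _
      rw [TotalSpace.mk_inj]
      exact hsymm t'
    rw [heq]
    exact hDsT t
  /- the three scalar functions `f = |S|²`, `a = g(DS, S)`, `h = |DS|²` and their derivatives -/
  set fF : ℝ → ℝ := fun t ↦ g.val (γ t) (S t) (S t) with hfF
  set aF : ℝ → ℝ := fun t ↦ g.val (γ t) (DS t) (S t) with haF
  set hF : ℝ → ℝ := fun t ↦ g.val (γ t) (DS t) (DS t) with hhF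
  have ha : ∀ t, HasDerivAt aF
      (g.val (γ t) (covariantDerivAlong g.leviCivita γ DS t) (S t) + hF t) t :=
    fun t ↦ hasDerivAt_val_apply_along (g := g) hcompat (hDS t) (hS t)
  have hf : ∀ t, HasDerivAt fF (2 * aF t) t := fun t ↦ by
    have h := hasDerivAt_val_apply_along (g := g) hcompat (hS t) (hS t)
    have h' : g.val (γ t) (DS t) (S t) + g.val (γ t) (S t) (DS t) = 2 * aF t := by
      rw [g.symm (γ t) (S t) (DS t)]
      show aF t + aF t = 2 * aF t
      ring
    rw [h'] at h
    exact h
  have hh : ∀ t, HasDerivAt hF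
      (g.val (γ t) (covariantDerivAlong g.leviCivita γ DS t) (DS t) +
        g.val (γ t) (DS t) (covariantDerivAlong g.leviCivita γ DS t)) t :=
    fun t ↦ hasDerivAt_val_apply_along (g := g) hcompat (hDS t) (hDS t)
  have hfc : Continuous fF := continuous_iff_continuousAt.2 fun t ↦ (hf t).continuousAt
  have hac : Continuous aF := continuous_iff_continuousAt.2 fun t ↦ (ha t).continuousAt
  have hhc : Continuous hF := continuous_iff_continuousAt.2 fun t ↦ (hh t).continuousAt
  have hf_nn : ∀ t, 0 ≤ fF t := fun t ↦ hnn (γ t) (S t)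
  have hh_nn : ∀ t, 0 ≤ hF t := fun t ↦ hnn (γ t) (DS t)
  /- constant speed: `g(T, T) ≡ c = g_p(v, v)` -/
  obtain ⟨-, hgeo, hγ0, hγv⟩ := maximalGeodesic_of_isGeodesicallyComplete hc p (vT + (0 : ℝ) • wT)
  set c : ℝ := g.val p vT vT with hc_def
  have hc_nn : 0 ≤ c := hnn p vT
  have hTT : ∀ t, g.val (γ t) (T t) (T t) = c := by
    intro t
    have h := g.val_velocity_eq_of_isGeodesicOn_of_isCompatible hcompat isOpen_univ
      ordConnected_univ (hgeo.isGeodesicOn univ) (mem_univ t) (mem_univ 0)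
    have h0 : velocity I (maximalGeodesic g.leviCivita p (vT + (0 : ℝ) • wT)) 0 = vT := by
      rw [hγv, zero_smul, add_zero]
    have hp0 : maximalGeodesic g.leviCivita p (vT + (0 : ℝ) • wT) 0 = p := hγ0
    show g.val (maximalGeodesic g.leviCivita p (vT + (0 : ℝ) • wT) t)
      (velocity I (maximalGeodesic g.leviCivita p (vT + (0 : ℝ) • wT)) t)
      (velocity I (maximalGeodesic g.leviCivita p (vT + (0 : ℝ) • wT)) t) = c
    rw [h]
    -- now at parameter `0`
    have key : ∀ (y : M) (hy : y = p) (u : TangentSpace I y), HEq u vT → g.val y u u = c := by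
      intro y hy u hu
      subst hy
      have : u = vT := eq_of_heq hu
      rw [this]
    exact key _ hp0 _ (heq_of_eq h0)
  /- the curvature bound along `γ`: `Rm(S, T, T, S) ≤ Λ₊ c f` -/
  set Λp : ℝ := max Λ 0 with hΛp
  have hΛp0 : 0 ≤ Λp := le_max_right _ _
  have hΛpc : Λp * c < 2 := by
    rcases le_or_gt Λ 0 with hΛ | hΛ
    · rw [hΛp, max_eq_right hΛ, zero_mul]
      norm_num
    · rw [hΛp, max_eq_left hΛ.le]
      exact hv
  have hRm : ∀ t, g.curvatureForm g.leviCivita (γ t) (S t) (T t) (T t) (S t) ≤ Λp * c * fF t := by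
    intro t
    have h1 := hsec (γ t) (S t) (T t)
    have hgram : 0 ≤ g.val (γ t) (S t) (S t) * g.val (γ t) (T t) (T t) -
        g.val (γ t) (S t) (T t) ^ 2 := sub_nonneg.2 (sq_val_le_mul_val hnn (γ t) (S t) (T t))
    have h2 : Λ * (g.val (γ t) (S t) (S t) * g.val (γ t) (T t) (T t) -
        g.val (γ t) (S t) (T t) ^ 2) ≤ Λp * (g.val (γ t) (S t) (S t) * g.val (γ t) (T t) (T t) -
        g.val (γ t) (S t) (T t) ^ 2) := mul_le_mul_of_nonneg_right (le_max_left _ _) hgram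
    have h3 : Λp * (g.val (γ t) (S t) (S t) * g.val (γ t) (T t) (T t) -
        g.val (γ t) (S t) (T t) ^ 2) ≤ Λp * (g.val (γ t) (S t) (S t) * g.val (γ t) (T t) (T t)) :=
      mul_le_mul_of_nonneg_left (sub_le_self _ (sq_nonneg _)) hΛp0
    calc g.curvatureForm g.leviCivita (γ t) (S t) (T t) (T t) (S t)
        ≤ Λp * (g.val (γ t) (S t) (S t) * g.val (γ t) (T t) (T t) -
            g.val (γ t) (S t) (T t) ^ 2) := h1.trans h2
      _ ≤ Λp * (g.val (γ t) (S t) (S t) * g.val (γ t) (T t) (T t)) := h3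
      _ = Λp * c * fF t := by
          rw [hTT t]
          show _ = Λp * c * g.val (γ t) (S t) (S t)
          ring
  -- `a' ≥ h - Λ₊ c f`
  have ha' : ∀ t, hF t - Λp * c * fF t ≤
      g.val (γ t) (covariantDerivAlong g.leviCivita γ DS t) (S t) + hF t := by
    intro t
    have h1 : covariantDerivAlong g.leviCivita γ DS t =
        -g.leviCivita.curvature (γ t) (S t) (T t) (T t) :=
      eq_neg_of_add_eq_zero_left (hjac t)
    have h3 : g.val (γ t) (covariantDerivAlong g.leviCivita γ DS t) (S t) =
        -g.curvatureForm g.leviCivita (γ t) (S t) (T t) (T t) (S t) := by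
      rw [h1, map_neg]
      rfl
    have h4 := hRm t
    linarith
  /- the primitives `Hf = ∫₀ᵗ h`, `Ff = ∫₀ᵗ f` -/
  set Hf : ℝ → ℝ := fun t ↦ ∫ s in (0 : ℝ)..t, hF s with hHf
  set Ff : ℝ → ℝ := fun t ↦ ∫ s in (0 : ℝ)..t, fF s with hFf
  have hH : ∀ t, HasDerivAt Hf (hF t) t := fun t ↦ (hhc.integral_hasStrictDerivAt 0 t).hasDerivAt
  have hFd : ∀ t, HasDerivAt Ff (fF t) t := fun t ↦ (hfc.integral_hasStrictDerivAt 0 t).hasDerivAt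
  have hH0 : Hf 0 = 0 := by simp [hHf]
  have hF0 : Ff 0 = 0 := by simp [hFf]
  have hHc : Continuous Hf := continuous_iff_continuousAt.2 fun t ↦ (hH t).continuousAt
  have hHmono : Monotone Hf :=
    monotone_of_deriv_nonneg (fun t ↦ (hH t).differentiableAt) fun t ↦ by
      rw [(hH t).deriv]; exact hh_nn t
  /- initial and final values: `S 0 = 0`, `S 1 = 0` -/
  have hS0 : S 0 = 0 := velocity_geodesicVariation_zero hc p vT wT 0
  have hS1 : S 1 = 0 := by
    have h := velocity_geodesicVariation_eq_mfderiv_expMap hc p vT wT 1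
    rw [one_smul, one_smul] at h
    show velocity I (fun s' : ℝ ↦ maximalGeodesic g.leviCivita p (vT + s' • wT) 1) 0 = 0
    rw [h]
    exact hw
  have ha0 : aF 0 = 0 := by show g.val (γ 0) (DS 0) (S 0) = 0; rw [hS0, map_zero]
  have ha1 : aF 1 = 0 := by show g.val (γ 1) (DS 1) (S 1) = 0; rw [hS1, map_zero]
  have hf0 : fF 0 = 0 := by show g.val (γ 0) (S 0) (S 0) = 0; rw [hS0]; simp
  /- (A) `B = a - Hf + Λ₊ c Ff` is nondecreasing, so `Hf 1 ≤ Λ₊ c Ff 1` -/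
  have hB : ∀ t, HasDerivAt (fun t ↦ aF t - Hf t + Λp * c * Ff t)
      (g.val (γ t) (covariantDerivAlong g.leviCivita γ DS t) (S t) + hF t - hF t +
        Λp * c * fF t) t :=
    fun t ↦ ((ha t).sub (hH t)).add ((hFd t).const_mul (Λp * c))
  have hBmono : Monotone fun t ↦ aF t - Hf t + Λp * c * Ff t :=
    monotone_of_deriv_nonneg (fun t ↦ (hB t).differentiableAt) fun t ↦ by
      rw [(hB t).deriv]
      have := ha' t
      linarith
  have hA : Hf 1 ≤ Λp * c * Ff 1 := by
    have h := hBmono (zero_le_one : (0 : ℝ) ≤ 1)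
    simp only [ha0, ha1, hH0, hF0] at h
    linarith
  /- (B) `Q = Hf - f/t` is nondecreasing on `(0, ∞)` and tends to `0` at `0⁺`; so `f ≤ t Hf` -/
  have hquad : ∀ t : ℝ, 0 ≤ t ^ 2 * hF t - 2 * t * aF t + fF t := fun t ↦ by
    have h0 := hnn (γ t) (t • DS t - S t)
    have h1 : g.val (γ t) (t • DS t - S t) (t • DS t - S t) =
        t ^ 2 * hF t - 2 * t * aF t + fF t := by
      have hs : g.val (γ t) (S t) (DS t) = aF t := g.symm (γ t) (S t) (DS t)
      simp only [map_sub, map_smul, FunLike.coe_sub, FunLike.coe_smul,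
        Pi.sub_apply, Pi.smul_apply, smul_eq_mul, hs]
      show t * (t * hF t - aF t) - (t * aF t - fF t) = t ^ 2 * hF t - 2 * t * aF t + fF t
      ring
    rw [h1] at h0
    exact h0
  have hQ : ∀ t, t ≠ 0 → HasDerivAt (fun t ↦ Hf t - fF t / t)
      (hF t - (2 * aF t * t - fF t * 1) / t ^ 2) t :=
    fun t ht ↦ (hH t).sub ((hf t).div (hasDerivAt_id t) ht)
  have hQmono : MonotoneOn (fun t ↦ Hf t - fF t / t) (Ioi 0) := by
    refine monotoneOn_of_deriv_nonneg (convex_Ioi 0)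
      (fun t ht ↦ (hQ t (ne_of_gt ht)).continuousAt.continuousWithinAt)
      (fun t ht ↦ ?_) fun t ht ↦ ?_
    · rw [interior_Ioi] at ht
      exact (hQ t (ne_of_gt ht)).differentiableAt.differentiableWithinAt
    · rw [interior_Ioi] at ht
      have htpos : 0 < t := ht
      rw [(hQ t htpos.ne').deriv]
      have h1 : hF t - (2 * aF t * t - fF t * 1) / t ^ 2 =
          (t ^ 2 * hF t - 2 * t * aF t + fF t) / t ^ 2 := by
        field_simp
        ring
      rw [h1]
      exact div_nonneg (hquad t) (sq_nonneg t)
  have hQlim : Tendsto (fun t ↦ Hf t - fF t / t) (𝓝[>] 0) (𝓝 0) := by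
    have h1 : Tendsto Hf (𝓝[>] 0) (𝓝 0) := by
      have h := hHc.tendsto 0
      rw [hH0] at h
      exact h.mono_left nhdsWithin_le_nhds
    have h2 : Tendsto (fun t ↦ fF t / t) (𝓝[>] 0) (𝓝 0) := by
      have h := (hf 0).tendsto_slope_zero
      rw [ha0, mul_zero] at h
      have h' : Tendsto (fun t ↦ t⁻¹ • (fF (0 + t) - fF 0)) (𝓝[>] 0) (𝓝 0) :=
        h.mono_left (nhdsWithin_mono _ fun t (ht : 0 < t) ↦ ht.ne')
      refine h'.congr fun t ↦ ?_
      rw [zero_add, hf0, sub_zero, smul_eq_mul, inv_mul_eq_div]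
    have h := h1.sub h2
    rw [sub_zero] at h
    exact h
  have hfle : ∀ t, 0 < t → fF t ≤ t * Hf t := by
    intro t ht
    have hQt : 0 ≤ Hf t - fF t / t := by
      refine le_of_tendsto hQlim ?_
      filter_upwards [Ioc_mem_nhdsGT ht] with s hs
      exact hQmono hs.1 ht hs.2
    have h1 : fF t / t ≤ Hf t := by linarith
    rwa [div_le_iff₀ ht, mul_comm] at h1
  /- (C) `K = t² Hf / 2 - Ff` is nondecreasing on `[0, ∞)`, so `Ff 1 ≤ Hf 1 / 2` -/
  have hK : ∀ t, HasDerivAt (fun t ↦ t ^ 2 * Hf t / 2 - Ff t)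
      (t * Hf t + t ^ 2 * hF t / 2 - fF t) t := fun t ↦ by
    have h := (((hasDerivAt_pow 2 t).mul (hH t)).div_const 2).sub (hFd t)
    have he : (((2 : ℕ) : ℝ) * t ^ (2 - 1) * Hf t + t ^ 2 * hF t) / 2 - fF t =
        t * Hf t + t ^ 2 * hF t / 2 - fF t := by
      rw [show (2 - 1 : ℕ) = 1 from rfl, pow_one, Nat.cast_ofNat]
      ring
    rw [he] at h
    exact h
  have hKmono : MonotoneOn (fun t ↦ t ^ 2 * Hf t / 2 - Ff t) (Ici 0) := by
    refine monotoneOn_of_deriv_nonneg (convex_Ici 0)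
      (fun t _ ↦ (hK t).continuousAt.continuousWithinAt)
      (fun t _ ↦ (hK t).differentiableAt.differentiableWithinAt) fun t ht ↦ ?_
    rw [interior_Ici] at ht
    have htpos : 0 < t := ht
    rw [(hK t).deriv]
    have h1 := hfle t htpos
    have h2 : 0 ≤ t ^ 2 * hF t := mul_nonneg (sq_nonneg t) (hh_nn t)
    linarith
  have hC : Ff 1 ≤ Hf 1 / 2 := by
    have h := hKmono (mem_Ici.2 le_rfl) (mem_Ici.2 zero_le_one) zero_le_one
    simp only [hH0, hF0] at h
    norm_num at h
    linarith
  /- (D) `Hf 1 ≤ 0`, hence `f = 0` on `[0, 1]` -/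
  have hD : Hf 1 ≤ 0 := by
    have h1 : Hf 1 ≤ Λp * c * (Hf 1 / 2) :=
      hA.trans (mul_le_mul_of_nonneg_left hC (mul_nonneg hΛp0 hc_nn))
    nlinarith [hΛpc, hHmono (zero_le_one : (0:ℝ) ≤ 1), hH0]
  have hSt : ∀ t ∈ Icc (0 : ℝ) 1, S t = 0 := by
    intro t ht
    have hft : fF t = 0 := by
      rcases ht.1.eq_or_lt with h0 | htpos
      · rw [← h0]; exact hf0
      · have h1 := hfle t htpos
        have h2 : Hf t ≤ 0 := (hHmono ht.2).trans hD
        have h3 : t * Hf t ≤ 0 := mul_nonpos_of_nonneg_of_nonpos ht.1 h2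
        exact le_antisymm (h1.trans h3) (hf_nn t)
    exact CartanHadamard.eq_zero_of_val_self_eq_zero hg (γ t) hft
  -- `d(exp_p)_{tv}(w) = 0` for `0 < t < 1`
  have hY : ∀ t ∈ Ioo (0 : ℝ) 1,
      mfderiv 𝓘(ℝ, E) I (fun u : E ↦ expMap g.leviCivita p (show TangentSpace I p from u))
        (t • v) w = 0 := by
    intro t ht
    have h := velocity_geodesicVariation_eq_mfderiv_expMap hc p vT wT t
    have hS' : velocity I (fun s' : ℝ ↦ maximalGeodesic g.leviCivita p (vT + s' • wT) t) 0 = 0 :=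
      hSt t ⟨ht.1.le, ht.2.le⟩
    rw [hS'] at h
    have h' : mfderiv 𝓘(ℝ, E) I
        (fun u : E ↦ expMap g.leviCivita p (show TangentSpace I p from u)) (t • v) (t • w) = 0 :=
      h.symm
    have h'' : t • mfderiv 𝓘(ℝ, E) I
        (fun u : E ↦ expMap g.leviCivita p (show TangentSpace I p from u)) (t • v) w = 0 :=
      (map_smul (mfderiv 𝓘(ℝ, E) I
        (fun u : E ↦ expMap g.leviCivita p (show TangentSpace I p from u)) (t • v)) t w).symm.trans h'
    exact (smul_eq_zero.1 h'').resolve_left ht.1.ne'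
  -- pass to the limit `t → 0⁺` in `TM`
  have hL := CartanHadamard.continuous_lift_mfderiv_expMap_line (I := I) hc p v w
  have hbase : Continuous fun t : ℝ ↦ expMap g.leviCivita p (show TangentSpace I p from t • v) := by
    have h := (contMDiff_expMap_infty hc p).continuous
    exact h.comp (continuous_id.smul continuous_const)
  have hZ : Continuous fun t : ℝ ↦
      (TotalSpace.mk' E (expMap g.leviCivita p (show TangentSpace I p from t • v))
        (0 : TangentSpace I (expMap g.leviCivita p (show TangentSpace I p from t • v))) :
          TangentBundle I M) :=
    (Trivialization.continuous_zeroSection ℝ (F := E) (E := (TangentSpace I : M → Type _))).comp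
      hbase
  have h0 := CartanHadamard.eq_of_eqOn_Ioo (I := I) hL hZ fun t ht ↦ by
    rw [TotalSpace.ext_iff]
    exact ⟨rfl, by simp only [hY t ht, heq_eq_eq]⟩
  have h1 : mfderiv 𝓘(ℝ, E) I (fun u : E ↦ expMap g.leviCivita p (show TangentSpace I p from u))
      ((0 : ℝ) • v) w = 0 := TotalSpace.mk_inj.1 h0
  rw [zero_smul] at h1
  have h3 := DFunLike.congr_fun (hasMFDerivAt_expMap_zero (I := I) hc p).mfderiv w
  change mfderiv 𝓘(ℝ, E) I (fun u : E ↦ expMap g.leviCivita p (show TangentSpace I p from u))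
      0 w = w at h3
  exact h3.symm.trans h1

/-! ### Riemannian restatements and Weinstein's step (4) in point form -/

section Riemannian

omit [Fact (1 ≤ n)] [CovariantDerivative.ContMDiffCovariantDerivative g.leviCivita 1]
  [CovariantDerivative.ContMDiffCovariantDerivative g.leviCivita ∞]

/-- **Short vectors are not conjugate under a curvature bound** (Lee 2018, Thm. 11.12 (b), weak
form): for a smooth (`∞ ≤ n`) Riemannian metric with geodesically complete Levi-Civita connection
and sectional curvature `≤ Λ` (`Rm(X,Y,Y,X) ≤ Λ (g(X,X) g(Y,Y) - g(X,Y)²)`), a vector `v ∈ T_pM`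
with `Λ g_p(v,v) < 2` is not a conjugate vector of `exp_p`
(`mfderiv_expMap_injective_of_curvatureForm_le`). [cite: LeeRiemannianManifolds2018, Thm. 11.12 (b) (weak form) and Prop. 10.20] -/
theorem not_isConjugateVector_of_curvatureForm_le (hn : (∞ : ℕ∞ω) ≤ n) (hg : g.IsRiemannian)
    {Λ : ℝ} (hsec : ∀ (x : M) (X Y : TangentSpace I x), g.curvatureForm g.leviCivita x X Y Y X ≤
      Λ * (g.val x X X * g.val x Y Y - g.val x X Y ^ 2))
    (hc : IsGeodesicallyComplete g.leviCivita) (p : M) {v : TangentSpace I p}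
    (hv : Λ * g.val p v v < 2) : ¬ IsConjugateVector g p v := by
  haveI := fact_one_le_of_infty_le hn
  haveI : CovariantDerivative.ContMDiffCovariantDerivative g.leviCivita ∞ :=
    contMDiffCovariantDerivative_leviCivita_infty g hn
  haveI : CovariantDerivative.ContMDiffCovariantDerivative g.leviCivita 1 :=
    ⟨g.isLocallyContMDiff_leviCivita_holds 1 (le_trans (by exact_mod_cast le_top) hn) univ
      isOpen_univ⟩
  have hcov₁ : g.leviCivita.IsLocallyContMDiff 1 :=
    g.isLocallyContMDiff_leviCivita_holds 1 (le_trans (by exact_mod_cast le_top) hn)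
  intro hcv
  exact hcv.2 (mfderiv_expMap_injective_of_curvatureForm_le hg hsec hcov₁ hc p hv)

/-- **Weinstein's step (4) in point form: small eccentricity relative to the curvature bound
⇒ every cut point has multiplicity `≥ 2`.** On a compact connected Hausdorff manifold without
boundary with a smooth Riemannian metric of sectional curvature `≤ Λ`, let `p` be a point with
`Λ d(p,q)² < 2` for all `q` (every point is seen from `p` within the conjugate radius bound of
`mfderiv_expMap_injective_of_curvatureForm_le`). Then no tangent cut vector of `p` is conjugate
(a cut vector `v` has `|v| = d(p, exp_p v)`, `edist_eq_of_isMinimizingUpTo`), so by the bridge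
`two_le_minimalGeodesicMultiplicity_of_forall_not_isConjugateVector` every `q ∈ cutLocus g hg p` is
joined to `p` by two distinct minimal geodesics. This is the shape of the last step of Weinstein's
proof (zbMATH 0159.23902: the cut vectors of the constructed metric are short and a comparison
theorem excludes conjugate points on short geodesics), here with conjugate points of `p` in place
of Warner's focal points of `∂D`. [cite: Weinstein1968, main theorem (step 4 of the proof)]
[cite: LeeRiemannianManifolds2018, Thm. 11.12 (b) (weak form)] -/
theorem two_le_minimalGeodesicMultiplicity_of_curvatureForm_le_of_edist_lt [CompactSpace M]
    [ConnectedSpace M] (hn : (∞ : ℕ∞ω) ≤ n) (hg : g.IsRiemannian) {Λ : ℝ}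
    (hsec : ∀ (x : M) (X Y : TangentSpace I x), g.curvatureForm g.leviCivita x X Y Y X ≤
      Λ * (g.val x X X * g.val x Y Y - g.val x X Y ^ 2))
    {p : M} (hshort : ∀ q : M, Λ * (g.edist hg p q).toReal ^ 2 < 2) :
    ∀ q ∈ cutLocus g hg p, 2 ≤ minimalGeodesicMultiplicity g hg p q := by
  haveI := fact_one_le_of_infty_le hn
  haveI : CovariantDerivative.ContMDiffCovariantDerivative g.leviCivita 1 :=
    ⟨g.isLocallyContMDiff_leviCivita_holds 1 (le_trans (by exact_mod_cast le_top) hn) univ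
      isOpen_univ⟩
  have hc : IsGeodesicallyComplete g.leviCivita := hopfRinow_compact_geodesicallyComplete hn hg
  refine two_le_minimalGeodesicMultiplicity_of_forall_not_isConjugateVector hn hg fun v hv ↦
    not_isConjugateVector_of_curvatureForm_le hn hg hsec hc p ?_
  -- `|v|² = d(p, exp_p v)²`
  have hd : g.edist hg p (riemannianExpMap g p v) = ENNReal.ofReal (Real.sqrt (g.val p v v)) :=
    edist_eq_of_isMinimizingUpTo hg hc hv.2.1
  have hnn : 0 ≤ g.val p v v := (hg p v hv.1).le
  have h1 : (g.edist hg p (riemannianExpMap g p v)).toReal ^ 2 = g.val p v v := by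
    rw [hd, ENNReal.toReal_ofReal (Real.sqrt_nonneg _), Real.sq_sqrt hnn]
  have h2 := hshort (riemannianExpMap g p v)
  rw [h1] at h2
  exact h2

end Riemannian

end Literature.Geometry.Riemannian

end
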